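import Summits.Ventures.YMGap.RobustBall.UniformMassGap
import Literature.MathematicalPhysics.QuantumFieldTheory.Sweep1ShenZhuZhuProofs
import HarnessLib

/-!
# Venture YMGap, track ROBUST-BALL (Y2) — uniform exponential decay of the plaquette two-point function on
# the balls (the Literature currency `HasUniformExponentialDecay`)

HONEST FRAMING. WHAT THIS IS: a venture file (cell `pub-ymgap`, track Y2 ROBUST-BALL, seat rb-p1, theorems
only). The uniform `ℤ^d` currencies of `UniformMassGap.lean` (`PerturbedClustering[S]`, `UniformMassGapOn…`)
carry ONE rate `m` and ONE constant `A` for every member of a ball and every DLR state. Read on the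
normalised plaquette observables `W_p = (1/N) Re tr U_p` (`zdPlaquetteObs`, Lipschitz cylinders with constant
`4N³` on four links, `isLipschitzCylinder_zdPlaquetteObs`) this is UNIFORM EXPONENTIAL DECAY OF THE CONNECTED
PLAQUETTE TWO-POINT FUNCTION in the sup norm of `ℤ^d`, at the SAME rate `m`:
* `abs_cov_zdPlaquetteObs_le_of_decay_sup` — the sup-norm twin of the tree's
  `abs_cov_zdPlaquetteObs_le_of_decay` (which trades `√d` of the rate for the Euclidean norm): a clustering
  clause at support bound `4` with `(c, c₁)` gives `|Cov_μ(W_p(x), W_q(y))| ≤ C(N, c, c₁) e^{-c ‖x - y‖_∞}`,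
  `C = max(max(c₁,0) e^{2c} (16N⁶ + 1), 4e^{2c})`;
* `PerturbedClustering.abs_cov_plaquette_le` / `PerturbedClusteringS.abs_cov_plaquette_le` — for a member with
  clustering data `(m, A)`: every DLR state, every pair of plaquettes: `|Cov| ≤ C(N, m, 16A) e^{-m‖x-y‖_∞}`;
* ball level, in the Literature's uniform currency `HasUniformExponentialDecay` (one constant for the whole
  index family): `UniformMassGapOnBallZd.hasUniformExponentialDecay_plaquette` — the family of connected
  plaquette two-point functions `x ↦ Cov_μ(W_{x₀}(ij), W_{x₀+x}(kl))` indexed by (member of `MemBallZd ε₀ ε₁ R`,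
  DLR state) decays at rate `m` uniformly; twins `…ZdS…`, `…ZdG…` (ds-2's gauge ball), `…LoopBall…` (generic
  Wilson-type loop actions `‖c‖_w ≤ ε`), and the explicit-constant forms `….abs_cov_plaquette_le`.
WHAT THIS IS NOT: cells with numbers are in the row files (`UniformMassGapKR/S/ZdG.lean`) — apply these theorems to
them; `W_p` is the normalised `(1/N) Re tr` plaquette (the tree's `plaquetteCorrFn` uses the un-normalised
`Re tr`, a factor `N²`); strong-coupling LATTICE statements, nothing about the continuum or a Clay-sense mass gap.

## References
* Shen–Zhu–Zhu, CMP 400 (2023), Cor. 1.6; Friedli–Velenik (2017) §3.7.4 (uniform exponential decay).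
* The tree: `Literature/…/Sweep1ShenZhuZhuProofs.lean` (`abs_cov_zdPlaquetteObs_le_of_decay` and its helpers,
  followed line by line), `Literature/Probability/LatticeModels/CorrelationDecay.lean` (`HasUniformExponentialDecay`).
-/

noncomputable section

open MeasureTheory Filter Function ProbabilityTheory Real
open scoped NNReal
open Literature.Probability.LatticeModels
open Literature.Probability.LatticeModels.DobrushinMetric
open Literature.MathematicalPhysics.QuantumLattice
open Literature.MathematicalPhysics.QuantumFieldTheory hiding ZdEdge Site

namespace Summit.Ventures.YMGap.RobustBall

variable {d N : ℕ}

/-! ### The sup-norm plaquette bound from a clustering clause at support bound `4` -/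

/-- **Exponential decay of plaquette–plaquette covariances in the SUP NORM, full rate** (the tree's
`abs_cov_zdPlaquetteObs_le_of_decay` with `‖x − y‖_∞` in place of the Euclidean `latticeNorm`, so no `√d` is
lost): a clustering clause at support bound `4` with rate `c > 0` and constant `c₁` gives
`|Cov_μ(W_p(x), W_q(y))| ≤ max(max(c₁,0) e^{2c} (4N³·4N³ + 1), 4e^{2c}) · e^{-c‖x − y‖_∞}` (far plaquettes: disjoint
supports at edge distance `≥ ‖x−y‖_∞ − 2`; near ones: `|Cov| ≤ 4`). [folklore] -/
theorem abs_cov_zdPlaquetteObs_le_of_decay_sup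
    {μ : Measure (LGConfig d (Matrix.specialUnitaryGroup (Fin N) ℂ))} [IsProbabilityMeasure μ]
    {c c₁ : ℝ} (hc : 0 < c)
    (hc₁ : ∀ (F₁ F₂ : LGConfig d (Matrix.specialUnitaryGroup (Fin N) ℂ) → ℝ)
      (Λ₁ Λ₂ : Finset (ZdEdge d)) (K₁ K₂ : ℝ≥0),
      Λ₁.card ≤ 4 → Λ₂.card ≤ 4 → Disjoint Λ₁ Λ₂ →
      IsLipschitzCylinder (fundamentalRep (Fin N)) F₁ Λ₁ K₁ →
      IsLipschitzCylinder (fundamentalRep (Fin N)) F₂ Λ₂ K₂ →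
        |cov[F₁, F₂; μ]| ≤ c₁ * Real.exp (-c * setDistEdges Λ₁ Λ₂) *
          ((K₁ : ℝ) * K₂ + Real.sqrt (∫ U, F₁ U ^ 2 ∂μ) * Real.sqrt (∫ U, F₂ U ^ 2 ∂μ)))
    (x y : Literature.Probability.LatticeModels.Site d) {i j k l : Fin d} (hij : i < j) (hkl : k < l) :
    |cov[zdPlaquetteObs (fundamentalRep (Fin N)) x i j,
        zdPlaquetteObs (fundamentalRep (Fin N)) y k l; μ]| ≤
      max (max c₁ 0 * Real.exp (2 * c) *
          (((4 * (N : ℝ≥0) ^ 3 : ℝ≥0) : ℝ) * ((4 * (N : ℝ≥0) ^ 3 : ℝ≥0) : ℝ) + 1))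
        (4 * Real.exp (2 * c)) * Real.exp (-c * ‖x - y‖) := by
  have hρu : ∀ g, fundamentalRep (Fin N) g ∈ Matrix.unitaryGroup (Fin N) ℂ :=
    fundamentalRep_mem_unitaryGroup
  have hLm : c * ‖x - y‖ ≤ c * ‖x - y‖ := le_rfl
  have hne_p : (plaquetteEdges ((x, ⟨(i, j), hij⟩) : ZdPlaquette d)).Nonempty :=
    ⟨(x, i), by simp [plaquetteEdges]⟩
  have hne_q : (plaquetteEdges ((y, ⟨(k, l), hkl⟩) : ZdPlaquette d)).Nonempty :=
    ⟨(y, k), by simp [plaquetteEdges]⟩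
  by_cases hdisj : Disjoint (plaquetteEdges ((x, ⟨(i, j), hij⟩) : ZdPlaquette d))
      (plaquetteEdges ((y, ⟨(k, l), hkl⟩) : ZdPlaquette d))
  · have hcov := hc₁ _ _ _ _ _ _ (card_plaquetteEdges_le _) (card_plaquetteEdges_le _) hdisj
      (isLipschitzCylinder_zdPlaquetteObs x hij) (isLipschitzCylinder_zdPlaquetteObs y hkl)
    have hD : ‖x - y‖ - 2 ≤ setDistEdges (plaquetteEdges ((x, ⟨(i, j), hij⟩) : ZdPlaquette d))
        (plaquetteEdges ((y, ⟨(k, l), hkl⟩) : ZdPlaquette d)) := by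
      refine le_setDistEdges_of_forall hne_p hne_q fun e he e' he' => ?_
      have h1 := norm_fst_sub_le_of_mem_plaquetteEdges he
      have h2 := norm_fst_sub_le_of_mem_plaquetteEdges he'
      have heq : x - y = (e.1 - e'.1) - (e.1 - x) + (e'.1 - y) := by abel
      calc ‖x - y‖ - 2 = ‖(e.1 - e'.1) - (e.1 - x) + (e'.1 - y)‖ - 2 := by rw [← heq]
        _ ≤ ‖e.1 - e'.1‖ + ‖e.1 - x‖ + ‖e'.1 - y‖ - 2 := by
            gcongr
            exact (norm_add_le _ _).trans (add_le_add (norm_sub_le _ _) le_rfl)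
        _ ≤ ‖e.1 - e'.1‖ := by simp only at h1 h2; linarith
    have hL2 : ∀ (z : Literature.Probability.LatticeModels.Site d) (i' j' : Fin d),
        Real.sqrt (∫ U, zdPlaquetteObs (fundamentalRep (Fin N)) z i' j' U ^ 2 ∂μ) ≤ 1 := by
      intro z i' j'
      have hb : ∀ U, |zdPlaquetteObs (fundamentalRep (Fin N)) z i' j' U ^ 2| ≤ 1 := fun U => by
        rw [abs_pow]
        exact pow_le_one₀ (abs_nonneg _) (abs_zdPlaquetteObs_le hρu z i' j' U)
      have hint := norm_integral_le_of_norm_le_const (μ := μ)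
        (f := fun U => zdPlaquetteObs (fundamentalRep (Fin N)) z i' j' U ^ 2) (C := 1)
        (ae_of_all _ fun U => by simpa only [Real.norm_eq_abs] using hb U)
      have h1 : ∫ U, zdPlaquetteObs (fundamentalRep (Fin N)) z i' j' U ^ 2 ∂μ ≤ 1 :=
        (le_abs_self _).trans (by simpa [Real.norm_eq_abs] using hint)
      calc Real.sqrt _ ≤ Real.sqrt 1 := Real.sqrt_le_sqrt h1
        _ = 1 := Real.sqrt_one
    exact decay_bound_aux hc hcov (mul_nonneg (NNReal.coe_nonneg _) (NNReal.coe_nonneg _))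
      (Real.sqrt_nonneg _) (hL2 _ _ _) (Real.sqrt_nonneg _) (hL2 _ _ _) hD hLm
  · have hnear : ‖x - y‖ ≤ 2 := by
      obtain ⟨e, hep, heq⟩ := Finset.not_disjoint_iff.1 hdisj
      have h1 := norm_fst_sub_le_of_mem_plaquetteEdges hep
      have h2 := norm_fst_sub_le_of_mem_plaquetteEdges heq
      simp only at h1 h2
      have : x - y = (e.1 - y) - (e.1 - x) := by abel
      rw [this]
      exact (norm_sub_le _ _).trans (by linarith)
    exact near_bound_aux hc (abs_covariance_le_four (abs_zdPlaquetteObs_le hρu x i j)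
      (abs_zdPlaquetteObs_le hρu y k l)) hnear hLm

/-! ### Members with clustering data `(m, A)`: the plaquette two-point function -/

section Member

variable {β m A : ℝ} {W : Potential (ZdEdge d) (Matrix.specialUnitaryGroup (Fin N) ℂ)}
  {supp : Finset (ZdEdge d) → Finset (Finset (ZdEdge d))}

/-- **Plaquette two-point decay of a member with clustering data `(m, A)`**: for every DLR state `μ` of
`N β S_W + W` and every two plaquettes, `|Cov_μ(W_p(x), W_q(y))| ≤ max(max(16A,0) e^{2m}(4N³·4N³+1), 4e^{2m}) e^{-m‖x−y‖_∞}`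
(`PerturbedClustering` at `n = 4`, `abs_cov_zdPlaquetteObs_le_of_decay_sup`). [folklore] -/
theorem PerturbedClustering.abs_cov_plaquette_le (h : PerturbedClustering d N β W supp m A) (hm : 0 < m)
    {μ : Measure (LGConfig d (Matrix.specialUnitaryGroup (Fin N) ℂ))}
    (hμ : μ ∈ perturbedGibbsMeasures (d := d) (fundamentalRep (Fin N)) (N * β) W supp)
    (x y : Literature.Probability.LatticeModels.Site d) {i j k l : Fin d} (hij : i < j) (hkl : k < l) :
    |cov[zdPlaquetteObs (fundamentalRep (Fin N)) x i j,
        zdPlaquetteObs (fundamentalRep (Fin N)) y k l; μ]| ≤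
      max (max (A * (4 : ℕ) ^ 2) 0 * Real.exp (2 * m) *
          (((4 * (N : ℝ≥0) ^ 3 : ℝ≥0) : ℝ) * ((4 * (N : ℝ≥0) ^ 3 : ℝ≥0) : ℝ) + 1))
        (4 * Real.exp (2 * m)) * Real.exp (-m * ‖x - y‖) := by
  have hμ' : IsGibbsMeasure (perturbedYM (d := d) (fundamentalRep (Fin N)) (N * β) W supp) μ := hμ
  haveI := hμ'.isProbabilityMeasure
  refine abs_cov_zdPlaquetteObs_le_of_decay_sup hm (fun F₁ F₂ Λ₁ Λ₂ K₁ K₂ h₁ h₂ hdj hF₁ hF₂ => ?_) x y hij hkl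
  have := h μ hμ 4 F₁ F₂ Λ₁ Λ₂ K₁ K₂ h₁ h₂ hdj hF₁ hF₂
  simpa only [Nat.cast_ofNat] using this

/-- The tier-2 twin: plaquette two-point decay for a summable member with clustering data `(m, A)`. [folklore] -/
theorem PerturbedClusteringS.abs_cov_plaquette_le (h : PerturbedClusteringS d N β W m A) (hm : 0 < m)
    {μ : Measure (LGConfig d (Matrix.specialUnitaryGroup (Fin N) ℂ))}
    (hμ : μ ∈ perturbedGibbsMeasuresS (d := d) (fundamentalRep (Fin N)) (N * β) W)
    (x y : Literature.Probability.LatticeModels.Site d) {i j k l : Fin d} (hij : i < j) (hkl : k < l) :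
    |cov[zdPlaquetteObs (fundamentalRep (Fin N)) x i j,
        zdPlaquetteObs (fundamentalRep (Fin N)) y k l; μ]| ≤
      max (max (A * (4 : ℕ) ^ 2) 0 * Real.exp (2 * m) *
          (((4 * (N : ℝ≥0) ^ 3 : ℝ≥0) : ℝ) * ((4 * (N : ℝ≥0) ^ 3 : ℝ≥0) : ℝ) + 1))
        (4 * Real.exp (2 * m)) * Real.exp (-m * ‖x - y‖) := by
  have hμ' : IsGibbsMeasure (perturbedYMS (d := d) (fundamentalRep (Fin N)) (N * β) W) μ := hμ
  haveI := hμ'.isProbabilityMeasure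
  refine abs_cov_zdPlaquetteObs_le_of_decay_sup hm (fun F₁ F₂ Λ₁ Λ₂ K₁ K₂ h₁ h₂ hdj hF₁ hF₂ => ?_) x y hij hkl
  have := h μ hμ 4 F₁ F₂ Λ₁ Λ₂ K₁ K₂ h₁ h₂ hdj hF₁ hF₂
  simpa only [Nat.cast_ofNat] using this

end Member

/-! ### The balls: uniform exponential decay of the plaquette two-point function -/

section Balls

variable {β ε₀ ε₁ R a Λ t w ε m A : ℝ}

/-- **UNIFORM PLAQUETTE TWO-POINT DECAY ON THE TIER-1 BALL, explicit constant**: under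
`UniformMassGapOnBallZd d N β ε₀ ε₁ R m A`, for EVERY member, EVERY DLR state and every two plaquettes,
`|Cov(W_p(x), W_q(y))| ≤ C e^{-m‖x−y‖_∞}` with ONE `C = max(max(16A,0)e^{2m}(16N⁶+1), 4e^{2m})`. [folklore] -/
theorem UniformMassGapOnBallZd.abs_cov_plaquette_le (h : UniformMassGapOnBallZd d N β ε₀ ε₁ R m A)
    {W : Potential (ZdEdge d) (Matrix.specialUnitaryGroup (Fin N) ℂ)}
    {supp : Finset (ZdEdge d) → Finset (Finset (ZdEdge d))} (hW : MemBallZd ε₀ ε₁ R W supp)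
    {μ : Measure (LGConfig d (Matrix.specialUnitaryGroup (Fin N) ℂ))}
    (hμ : μ ∈ perturbedGibbsMeasures (d := d) (fundamentalRep (Fin N)) (N * β) W supp)
    (x y : Literature.Probability.LatticeModels.Site d) {i j k l : Fin d} (hij : i < j) (hkl : k < l) :
    |cov[zdPlaquetteObs (fundamentalRep (Fin N)) x i j,
        zdPlaquetteObs (fundamentalRep (Fin N)) y k l; μ]| ≤
      max (max (A * (4 : ℕ) ^ 2) 0 * Real.exp (2 * m) *
          (((4 * (N : ℝ≥0) ^ 3 : ℝ≥0) : ℝ) * ((4 * (N : ℝ≥0) ^ 3 : ℝ≥0) : ℝ) + 1))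
        (4 * Real.exp (2 * m)) * Real.exp (-m * ‖x - y‖) :=
  (h.2 W supp hW).2.abs_cov_plaquette_le h.1 hμ x y hij hkl

/-- **The Literature currency, tier 1**: the connected plaquette two-point functions
`x ↦ Cov_μ(W_{x₀}(ij), W_{x₀+x}(kl))`, indexed by the members `(W, supp)` of `MemBallZd ε₀ ε₁ R` together with
their DLR states `μ`, decay exponentially at rate `m` UNIFORMLY in the index (`HasUniformExponentialDecay`:
one constant for the whole ball). [folklore] -/
theorem UniformMassGapOnBallZd.hasUniformExponentialDecay_plaquette (h : UniformMassGapOnBallZd d N β ε₀ ε₁ R m A)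
    (x₀ : Literature.Probability.LatticeModels.Site d) {i j k l : Fin d} (hij : i < j) (hkl : k < l) :
    HasUniformExponentialDecay
      (fun (p : {p : (Potential (ZdEdge d) (Matrix.specialUnitaryGroup (Fin N) ℂ) ×
          (Finset (ZdEdge d) → Finset (Finset (ZdEdge d)))) ×
          Measure (LGConfig d (Matrix.specialUnitaryGroup (Fin N) ℂ)) //
          MemBallZd ε₀ ε₁ R p.1.1 p.1.2 ∧
            p.2 ∈ perturbedGibbsMeasures (d := d) (fundamentalRep (Fin N)) (N * β) p.1.1 p.1.2})
        (x : Literature.Probability.LatticeModels.Site d) =>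
        cov[zdPlaquetteObs (fundamentalRep (Fin N)) x₀ i j,
          zdPlaquetteObs (fundamentalRep (Fin N)) (x₀ + x) k l; p.1.2]) m := by
  refine ⟨h.1, max (max (A * (4 : ℕ) ^ 2) 0 * Real.exp (2 * m) *
      (((4 * (N : ℝ≥0) ^ 3 : ℝ≥0) : ℝ) * ((4 * (N : ℝ≥0) ^ 3 : ℝ≥0) : ℝ) + 1)) (4 * Real.exp (2 * m)),
    fun p x => ?_⟩
  have := h.abs_cov_plaquette_le p.2.1 p.2.2 x₀ (x₀ + x) hij hkl
  rwa [show x₀ - (x₀ + x) = -x by abel, norm_neg] at this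

/-- **UNIFORM PLAQUETTE TWO-POINT DECAY ON THE TIER-2 (WEIGHTED) BALL**, explicit constant. [folklore] -/
theorem UniformMassGapOnBallZdS.abs_cov_plaquette_le (h : UniformMassGapOnBallZdS d N β a Λ t m A)
    {W : Potential (ZdEdge d) (Matrix.specialUnitaryGroup (Fin N) ℂ)} (hW : MemBallZdS a Λ t W)
    {μ : Measure (LGConfig d (Matrix.specialUnitaryGroup (Fin N) ℂ))}
    (hμ : μ ∈ perturbedGibbsMeasuresS (d := d) (fundamentalRep (Fin N)) (N * β) W)
    (x y : Literature.Probability.LatticeModels.Site d) {i j k l : Fin d} (hij : i < j) (hkl : k < l) :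
    |cov[zdPlaquetteObs (fundamentalRep (Fin N)) x i j,
        zdPlaquetteObs (fundamentalRep (Fin N)) y k l; μ]| ≤
      max (max (A * (4 : ℕ) ^ 2) 0 * Real.exp (2 * m) *
          (((4 * (N : ℝ≥0) ^ 3 : ℝ≥0) : ℝ) * ((4 * (N : ℝ≥0) ^ 3 : ℝ≥0) : ℝ) + 1))
        (4 * Real.exp (2 * m)) * Real.exp (-m * ‖x - y‖) :=
  (h.2 W hW).2.abs_cov_plaquette_le h.1 hμ x y hij hkl

/-- **The Literature currency, tier 2**: uniform exponential decay at rate `m` of the connected plaquette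
two-point functions over (member of `MemBallZdS a Λ t`, DLR state). [folklore] -/
theorem UniformMassGapOnBallZdS.hasUniformExponentialDecay_plaquette (h : UniformMassGapOnBallZdS d N β a Λ t m A)
    (x₀ : Literature.Probability.LatticeModels.Site d) {i j k l : Fin d} (hij : i < j) (hkl : k < l) :
    HasUniformExponentialDecay
      (fun (p : {p : Potential (ZdEdge d) (Matrix.specialUnitaryGroup (Fin N) ℂ) ×
          Measure (LGConfig d (Matrix.specialUnitaryGroup (Fin N) ℂ)) //
          MemBallZdS a Λ t p.1 ∧ p.2 ∈ perturbedGibbsMeasuresS (d := d) (fundamentalRep (Fin N)) (N * β) p.1})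
        (x : Literature.Probability.LatticeModels.Site d) =>
        cov[zdPlaquetteObs (fundamentalRep (Fin N)) x₀ i j,
          zdPlaquetteObs (fundamentalRep (Fin N)) (x₀ + x) k l; p.1.2]) m := by
  refine ⟨h.1, max (max (A * (4 : ℕ) ^ 2) 0 * Real.exp (2 * m) *
      (((4 * (N : ℝ≥0) ^ 3 : ℝ≥0) : ℝ) * ((4 * (N : ℝ≥0) ^ 3 : ℝ≥0) : ℝ) + 1)) (4 * Real.exp (2 * m)),
    fun p x => ?_⟩
  have := h.abs_cov_plaquette_le p.2.1 p.2.2 x₀ (x₀ + x) hij hkl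
  rwa [show x₀ - (x₀ + x) = -x by abel, norm_neg] at this

/-- **UNIFORM PLAQUETTE TWO-POINT DECAY ON ds-2's GAUGE-INVARIANT BALL**, explicit constant. [folklore] -/
theorem UniformMassGapOnBallZdG.abs_cov_plaquette_le {R : ℕ} (h : UniformMassGapOnBallZdG d N β ε₀ ε₁ R m A)
    {W : Potential (ZdEdge d) (SUN N)} {supp : Finset (ZdEdge d) → Finset (Finset (ZdEdge d))}
    (hW : MemBallZdG ε₀ ε₁ R W supp) {μ : Measure (LGConfig d (SUN N))}
    (hμ : μ ∈ perturbedGibbsMeasures (d := d) (fundamentalRep (Fin N)) (N * β) W supp)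
    (x y : Literature.Probability.LatticeModels.Site d) {i j k l : Fin d} (hij : i < j) (hkl : k < l) :
    |cov[zdPlaquetteObs (fundamentalRep (Fin N)) x i j,
        zdPlaquetteObs (fundamentalRep (Fin N)) y k l; μ]| ≤
      max (max (A * (4 : ℕ) ^ 2) 0 * Real.exp (2 * m) *
          (((4 * (N : ℝ≥0) ^ 3 : ℝ≥0) : ℝ) * ((4 * (N : ℝ≥0) ^ 3 : ℝ≥0) : ℝ) + 1))
        (4 * Real.exp (2 * m)) * Real.exp (-m * ‖x - y‖) :=
  (h.2 W supp hW).2.abs_cov_plaquette_le h.1 hμ x y hij hkl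

/-- **The Literature currency, gauge ball**: uniform exponential decay at rate `m` of the connected plaquette
two-point functions over (member of `MemBallZdG ε₀ ε₁ R`, DLR state). [folklore] -/
theorem UniformMassGapOnBallZdG.hasUniformExponentialDecay_plaquette {R : ℕ}
    (h : UniformMassGapOnBallZdG d N β ε₀ ε₁ R m A)
    (x₀ : Literature.Probability.LatticeModels.Site d) {i j k l : Fin d} (hij : i < j) (hkl : k < l) :
    HasUniformExponentialDecay
      (fun (p : {p : (Potential (ZdEdge d) (SUN N) × (Finset (ZdEdge d) → Finset (Finset (ZdEdge d)))) ×
          Measure (LGConfig d (SUN N)) //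
          MemBallZdG ε₀ ε₁ R p.1.1 p.1.2 ∧
            p.2 ∈ perturbedGibbsMeasures (d := d) (fundamentalRep (Fin N)) (N * β) p.1.1 p.1.2})
        (x : Literature.Probability.LatticeModels.Site d) =>
        cov[zdPlaquetteObs (fundamentalRep (Fin N)) x₀ i j,
          zdPlaquetteObs (fundamentalRep (Fin N)) (x₀ + x) k l; p.1.2]) m := by
  refine ⟨h.1, max (max (A * (4 : ℕ) ^ 2) 0 * Real.exp (2 * m) *
      (((4 * (N : ℝ≥0) ^ 3 : ℝ≥0) : ℝ) * ((4 * (N : ℝ≥0) ^ 3 : ℝ≥0) : ℝ) + 1)) (4 * Real.exp (2 * m)),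
    fun p x => ?_⟩
  have := h.abs_cov_plaquette_le p.2.1 p.2.2 x₀ (x₀ + x) hij hkl
  rwa [show x₀ - (x₀ + x) = -x by abel, norm_neg] at this

/-- **UNIFORM PLAQUETTE TWO-POINT DECAY ON THE LOOP-ACTION NORM BALL `‖c‖_w ≤ ε`**, explicit constant: for
EVERY generic Wilson-type loop action with finite carrier fibres and `LoopNormLE w γ c ε`, every DLR state,
every two plaquettes. [folklore] -/
theorem UniformMassGapOnLoopBall.abs_cov_plaquette_le (h : UniformMassGapOnLoopBall d N β w ε m A)
    {ι : Type} {γ : ι → ZdLoop d} {c : ι → ℝ} (hfin : ∀ X, {i | walkEdges (γ i).walk = X}.Finite)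
    (hn : LoopNormLE w γ c ε) {μ : Measure (LGConfig d (SUN N))}
    (hμ : μ ∈ perturbedGibbsMeasuresS (d := d) (fundamentalRep (Fin N)) (N * β) (loopFamilyAction (d := d) N γ c))
    (x y : Literature.Probability.LatticeModels.Site d) {i j k l : Fin d} (hij : i < j) (hkl : k < l) :
    |cov[zdPlaquetteObs (fundamentalRep (Fin N)) x i j,
        zdPlaquetteObs (fundamentalRep (Fin N)) y k l; μ]| ≤
      max (max (A * (4 : ℕ) ^ 2) 0 * Real.exp (2 * m) *
          (((4 * (N : ℝ≥0) ^ 3 : ℝ≥0) : ℝ) * ((4 * (N : ℝ≥0) ^ 3 : ℝ≥0) : ℝ) + 1))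
        (4 * Real.exp (2 * m)) * Real.exp (-m * ‖x - y‖) :=
  (h.2 ι γ c hfin hn).2.abs_cov_plaquette_le h.1 hμ x y hij hkl

end Balls

end Summit.Ventures.YMGap.RobustBall

end
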